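import Summits.MatrixMultiplication.MatrixMultiplication.Theorems.SoloInformedCwTwoAsymptoticSubrank
import Literature.Computability.AlgebraicComplexity.AsymptoticSubrankDuality
import Literature.Computability.AlgebraicComplexity.QuantumFunctionalPointHolds
import Literature.Computability.AlgebraicComplexity.QuantumFunctionalsBounds
import Summits.MatrixMultiplication.MatrixMultiplication.Theorems.SoloInformedCwTwoCubeKoszulFourRank

/-!
# The asymptotic spectrum at `T_{cw,2}`: door D1 is invisible to every known spectral point, in both directions

Solo seat `solo-MatrixMultiplication-informed` (ideation tier, family 6), generation 3, 2026-08-19.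

With `Q̃(T_{cw,2}) = 3` (`asymptoticSubrank_cwTensor_two_eq_three`) and Strassen duality
(`strassen_duality_asymptoticRank_holds`, `strassen_duality_asymptoticSubrank_holds`, both PROVED in the
Literature library) the door D1 `asymptoticRank (cwTensor ℂ 2) ≤ 3 → MatrixMultiplication` takes its
final spectral form, all in the kernel:

* `three_le_spectralPoint_cwTensor_two`, `spectralPoint_cwTensor_two_le_four` — every universal spectral
  point `F ∈ Δ(T(ℂ))` has `3 ≤ F(T_{cw,2}) ≤ 4`;
* (not restated here: every QUANTUM FUNCTIONAL — Christandl–Vrana–Zuiddam's universal spectral points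
  `F^θ`, `θ ∈ P([3])`, the only explicitly known points of `Δ(T(ℂ))` — takes the value exactly `3` at
  `T_{cw,2}`, CVZ Thm. 3.19.5 for `≤` and Cor. 3.31 + Prop. 1.6 for `≥`; this evaluation is already a
  theorem of the tree, landed independently of this seat);
* `forall_spectralPoint_cwTensor_two_eq_three_iff` — D1's hypothesis `R̃(T_{cw,2}) ≤ 3` ⟺ EVERY universal
  spectral point equals `3` at `T_{cw,2}` (the spectrum of `T_{cw,2}` is the single value `3`, i.e.
  `T_{cw,2} ~ ⟨3⟩`), and `matrixMultiplication_of_forall_spectralPoint_cwTensor_two_eq_three`;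
* `three_lt_asymptoticRank_cwTensor_two_iff` — the NEGATION of D1's hypothesis ⟺ some universal spectral
  point SEPARATES `T_{cw,2}` from `⟨3⟩` (`F(T_{cw,2}) > 3`), and `spectralPoint_ne_of_three_lt` — such a
  point differs from every point of value `≤ 3` there, so from every `F^θ`: refuting the door requires a
  NEW point of the asymptotic spectrum of `3 × 3 × 3` tensors, proving it requires a construction
  certifying `R̃ ≤ 3` (no known functional can); `cwTensor_two_spectral_dichotomy`.
* `pow_three_lt_algBorderRank_kroneckerPow_cwTensor_two` — at every finite level `N ≥ 3`,
  `R̲(T_{cw,2}^{⊠N}) > 3^N` (from the seat's certified Koszul bound): the equivalence `T_{cw,2} ~ ⟨3⟩` is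
  never an exact degeneration `T_{cw,2}^{⊠N} ⊴ ⟨3^N⟩`; a proof of D1 must use the `o(N)` slack.
* `two_lt_logb_of_asymptoticRank_cwTensor_lt` — uniqueness of the door: for `q ≥ 3` Coppersmith–Winograd's
  value bound `ω ≤ log_q(4ρ³/27)` (`ρ > R̃(T_{cw,q}) ≥ q + 1`, `omega_le_logb_of_asymptoticRank_cwTensor_lt`)
  is always `> 2`; only `q = 2` can reach `ω = 2` (`log₂(4·3³/27) = 2`, the tree's `logb_two_cw_two`).

References: V. Strassen, J. reine angew. Math. 384 (1988), Thm. 3.8; M. Christandl, P. Vrana,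
J. Zuiddam, J. Amer. Math. Soc. 36 (2023), Prop. 1.6, Thm. 3.19.5, Cor. 3.31; D. Coppersmith,
S. Winograd, J. Symbolic Comput. 9 (1990), §11; P. Bürgisser, M. Clausen, M. A. Shokrollahi (1997), p. 439.
-/

noncomputable section

namespace Summit.MatrixMultiplication.MatrixMultiplication.Theorems

open Literature.Computability.AlgebraicComplexity
open Literature.Barriers.MatrixMultiplication (flatteningRank_cwTensor flatteningRank_le_asymptoticRank)

/-! ## Every universal spectral point lies in `[3, 4]` at `T_{cw,2}` -/

/-- **`3 ≤ F(T_{cw,2})`** for every universal spectral point `F` over `ℂ` (`Q̃ ≤ F`, Strassen duality,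
and `Q̃(T_{cw,2}) = 3`). [cite: ChristandlVranaZuiddam2023, Prop. 1.6] -/
theorem three_le_spectralPoint_cwTensor_two {F : SpectralMap ℂ} (hF : IsUniversalSpectralPoint ℂ F) :
    (3 : ℝ) ≤ F (cwTensor ℂ 2) := by
  have h := (strassen_duality_asymptoticSubrank_holds ℂ (cwTensor ℂ 2)).1 F hF
  rwa [asymptoticSubrank_cwTensor_two_eq_three] at h

/-- **`F(T_{cw,2}) ≤ 4`** for every universal spectral point `F` over `ℂ` (`F ≤ R̃ ≤ 4`).
[cite: ChristandlVranaZuiddam2023, Prop. 1.6] -/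
theorem spectralPoint_cwTensor_two_le_four {F : SpectralMap ℂ} (hF : IsUniversalSpectralPoint ℂ F) :
    F (cwTensor ℂ 2) ≤ 4 :=
  ((strassen_duality_asymptoticRank_holds ℂ (cwTensor ℂ 2)).1 F hF).trans
    cwTensor_two_asymptotic_sandwich.2.2

/-! ## Every quantum functional equals `3` at `T_{cw,2}` -/

/-- **D1's hypothesis is "`T_{cw,2} ~ ⟨3⟩`"**: `R̃(T_{cw,2}) ≤ 3` iff every universal spectral point takes
the value `3` at `T_{cw,2}`. [cite: ChristandlVranaZuiddam2023, Prop. 1.6] -/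
theorem forall_spectralPoint_cwTensor_two_eq_three_iff :
    (∀ F, IsUniversalSpectralPoint ℂ F → F (cwTensor ℂ 2) = 3) ↔
      asymptoticRank (cwTensor ℂ 2) ≤ 3 := by
  constructor
  · intro h
    exact (forall_spectralPoint_cwTensor_two_le_iff 3).1 fun F hF => (h F hF).le
  · intro h F hF
    exact le_antisymm ((forall_spectralPoint_cwTensor_two_le_iff 3).2 h F hF)
      (three_le_spectralPoint_cwTensor_two hF)

/-- **`ω = 2` if the asymptotic spectrum does not see `T_{cw,2}`**: if every universal spectral point
over `ℂ` equals `3` at `T_{cw,2}`, then `ω = 2`. [cite: CoppersmithWinograd1990, §11]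
[cite: ChristandlVranaZuiddam2023, Prop. 1.6] -/
theorem matrixMultiplication_of_forall_spectralPoint_cwTensor_two_eq_three
    (h : ∀ F, IsUniversalSpectralPoint ℂ F → F (cwTensor ℂ 2) = 3) : _root_.MatrixMultiplication :=
  matrixMultiplication_of_asymptoticRank_cwTensor_two_le_three
    (forall_spectralPoint_cwTensor_two_eq_three_iff.1 h)

/-- **The negation of D1's hypothesis is a separating spectral point**: `R̃(T_{cw,2}) > 3` iff some
universal spectral point `F` has `F(T_{cw,2}) > 3` (attainment in Strassen duality).
[cite: ChristandlVranaZuiddam2023, Prop. 1.6] -/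
theorem three_lt_asymptoticRank_cwTensor_two_iff :
    3 < asymptoticRank (cwTensor ℂ 2) ↔
      ∃ F, IsUniversalSpectralPoint ℂ F ∧ 3 < F (cwTensor ℂ 2) := by
  constructor
  · intro h
    obtain ⟨F, hF, hFt⟩ := (strassen_duality_asymptoticRank_holds ℂ (cwTensor ℂ 2)).2
    exact ⟨F, hF, hFt ▸ h⟩
  · rintro ⟨F, hF, h3⟩
    exact h3.trans_le ((strassen_duality_asymptoticRank_holds ℂ (cwTensor ℂ 2)).1 F hF)

/-- A separating point differs from every spectral point taking the value `≤ 3` at `T_{cw,2}` — in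
particular (the quantum functionals take the value `3` there, CVZ Cor. 3.31 with all flattening ranks
of `T_{cw,2}` equal to `3`; landed in the tree independently of this seat) from every `F^θ`.
[cite: ChristandlVranaZuiddam2023, Cor. 3.31] -/
theorem spectralPoint_ne_of_three_lt {F G : SpectralMap ℂ} (h3 : 3 < F (cwTensor ℂ 2))
    (hG : G (cwTensor ℂ 2) ≤ 3) : F ≠ G := by
  rintro rfl
  exact absurd hG (not_le.2 h3)

/-- Summary: either every universal spectral point equals `3` at `T_{cw,2}` (and then `ω = 2`), or some
universal spectral point exceeds `3` there — a point separating `T_{cw,2}` from `⟨3⟩`, distinct from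
every spectral point of value `≤ 3` at `T_{cw,2}` (so from all quantum functionals).
[cite: ChristandlVranaZuiddam2023, Prop. 1.6, Cor. 3.31] -/
theorem cwTensor_two_spectral_dichotomy :
    (asymptoticRank (cwTensor ℂ 2) ≤ 3 ∧ _root_.MatrixMultiplication) ∨
      ∃ F, IsUniversalSpectralPoint ℂ F ∧ 3 < F (cwTensor ℂ 2) ∧
        ∀ G : SpectralMap ℂ, G (cwTensor ℂ 2) ≤ 3 → F ≠ G := by
  by_cases h : asymptoticRank (cwTensor ℂ 2) ≤ 3
  · exact Or.inl ⟨h, matrixMultiplication_of_asymptoticRank_cwTensor_two_le_three h⟩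
  · obtain ⟨F, hF, h3⟩ := three_lt_asymptoticRank_cwTensor_two_iff.1 (lt_of_not_ge h)
    exact Or.inr ⟨F, hF, h3, fun G hG => spectralPoint_ne_of_three_lt h3 hG⟩


/-! ## Finite levels: `T_{cw,2}^{⊠N} ≤ ⟨3^N⟩` fails for every `N ≥ 3` -/

/-- **No Kronecker power of `T_{cw,2}` has border rank `≤ 3^N`** (`N ≥ 3`; from the seat's
kernel-certified Koszul bound `3315 · 3^{N-3} ≤ 70 · R̲(T_{cw,2}^{⊠N})`, i.e. `R̲ ≥ 1.754 · 3^N`): the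
half `T_{cw,2}^{⊠N} ≤ ⟨3⟩^{⊗(N + o(N))}` of the asymptotic equivalence demanded by D1 is never an exact
degeneration `T_{cw,2}^{⊠N} ⊴ ⟨3^N⟩`; a proof of D1 must live in the `o(N)` slack.
[cite: ConnerGesmundoLandsbergVentura2022, Thm. 1.2 (iii), Prop. 3.2] -/
theorem pow_three_lt_algBorderRank_kroneckerPow_cwTensor_two {N : ℕ} (hN : 3 ≤ N) :
    3 ^ N < algBorderRank (kroneckerPow (cwTensor ℂ 2) N) := by
  have h := CubeP4.le_algBorderRank_kroneckerPow_cwTensor_two_p4 N hN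
  obtain ⟨M, rfl⟩ : ∃ M, N = M + 3 := ⟨N - 3, by omega⟩
  rw [Nat.add_sub_cancel] at h
  have hp : 0 < 3 ^ M := by positivity
  rw [pow_add]
  set t := 3 ^ M
  norm_num
  omega

/-! ## Uniqueness of the door: for `q ≥ 3` the Coppersmith–Winograd value bound stays above `2` -/

/-- For `q ≥ 3` and every `ρ ≥ q + 1`: `log_q(4ρ³/27) > 2` (`27 q² < 4 (q+1)³ ≤ 4ρ³`). [folklore] -/
theorem two_lt_logb_cw_value {q : ℕ} (hq : 3 ≤ q) {ρ : ℝ} (hρ : (q : ℝ) + 1 ≤ ρ) :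
    2 < Real.logb q (4 * ρ ^ 3 / 27) := by
  have hq1 : (1 : ℝ) < q := by exact_mod_cast (by omega : 1 < q)
  have hq0 : (0 : ℝ) < q := by positivity
  have hq3 : (3 : ℝ) ≤ q := by exact_mod_cast hq
  have hρ0 : 0 < ρ := by linarith
  have key : (q : ℝ) ^ 2 < 4 * ρ ^ 3 / 27 := by
    -- `4 (q+1)³ - 27 q² = (q - 3) (4q² - 3q + 3) + 13 > 0`
    have h0 : 0 ≤ ((q : ℝ) - 3) * (4 * (q : ℝ) ^ 2 - 3 * q + 3) :=
      mul_nonneg (by linarith) (by nlinarith)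
    have h1 : 27 * (q : ℝ) ^ 2 < 4 * ((q : ℝ) + 1) ^ 3 := by nlinarith
    have h2 : ((q : ℝ) + 1) ^ 3 ≤ ρ ^ 3 := by gcongr
    linarith
  have hlt : Real.logb q ((q : ℝ) ^ 2) < Real.logb q (4 * ρ ^ 3 / 27) :=
    Real.logb_lt_logb hq1 (by positivity) key
  have e : Real.logb q ((q : ℝ) ^ 2) = 2 := by
    rw [show ((q : ℝ) ^ 2) = (q : ℝ) ^ ((2 : ℕ) : ℝ) by rw [Real.rpow_natCast]]
    rw [Real.logb_rpow hq0 hq1.ne']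
    norm_num
  rwa [e] at hlt

/-- **Only `q = 2` can be a door of this shape**: for `q ≥ 3` and every `ρ > R̃(T_{cw,q})` the
Coppersmith–Winograd value bound `log_q(4ρ³/27)` of `omega_le_logb_of_asymptoticRank_cwTensor_lt` is
`> 2`, because `R̃(T_{cw,q}) ≥ q + 1` (flattening rank). [cite: CoppersmithWinograd1990, §11]
[cite: BurgisserClausenShokrollahi1997, Ex. 15.24 (7)] -/
theorem two_lt_logb_of_asymptoticRank_cwTensor_lt {q : ℕ} (hq : 3 ≤ q) {ρ : ℝ}
    (hρ : asymptoticRank (cwTensor ℂ q) < ρ) : 2 < Real.logb q (4 * ρ ^ 3 / 27) := by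
  have hflat := flatteningRank_le_asymptoticRank (cwTensor ℂ q)
  rw [flatteningRank_cwTensor (by omega : 1 ≤ q)] at hflat
  refine two_lt_logb_cw_value hq (le_of_lt (lt_of_le_of_lt ?_ hρ))
  exact_mod_cast hflat

end Summit.MatrixMultiplication.MatrixMultiplication.Theorems

end
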